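import Mathlib
import Summits.NavierStokesRegularity.NavierStokesRegularity.Theorems.TautLoopKelvinTautLoopLawStepCompositeTools
import Summits.NavierStokesRegularity.NavierStokesRegularity.Theorems.TautLoopKelvinTautLoopLawStepOpProductTools
import HarnessLib

/-!
# Route `TautLoopKelvin`, crux `TautLoopLaw` (stmt-NavierStokesRegularity-15249), line
  `Sketch-ideas-r1k1` (Dini–Saks architecture) — tools stub `stub_tautLoopWalk6AAux2`

Pure auxiliary lemmas for the assembly of the random-walk Kelvin selection (skeleton stub 6A
`stub_tautLoopWalkSelection`), part 2: the first-order expansion of the ordered product of the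
differentials `DA_k = 1 − τ Du_k + O(τ²)` along a deformed orbit
(`stub_tautLoopStepOpProductTools`), and the resulting `C¹` / derivative bounds for the
composite maps `Ψ_k = Φ_k ∘ ⋯ ∘ Φ_{n-1}`, `Φ_k = A_k + y_k` (`stub_tautLoopStepCompositeTools`):
`‖DΨ_0‖ ≤ e^{n(τβ+Kτ²)}` and `‖DΨ_0(x) − (1 − nτ T)‖ ≤ e^{n(τβ+Kτ²)}((n(τβ+Kτ²))² + nKτ²) + nτη`
when the slopes along the orbit are within `η` of `T`. Folklore.
-/

noncomputable section

open Set Function Filter Topology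

namespace Summit.NavierStokesRegularity.NavierStokesRegularity.Theorems

set_option linter.dupNamespace false

local notation3 "E3" => EuclideanSpace ℝ (Fin 3)

/-! ## Products of the differentials and the composite maps -/

/-- **First-order expansion of the ordered product of near-identity differentials.** If
`‖P_k − (1 − τ D_k)‖ ≤ K τ²`, `‖D_k‖ ≤ β` and `‖D_k − T‖ ≤ η`, then
`‖Π_k P_k‖ ≤ e^{n(τβ + Kτ²)}` and
`‖Π_k P_k − (1 − n τ T)‖ ≤ e^{n(τβ+Kτ²)}((n(τβ+Kτ²))² + n K τ²) + n τ η`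
(`stub_tautLoopStepOpProductTools` with `B_k = −D_k`, `E_k = P_k − (1 − τ D_k)`). [folklore] -/
theorem tautLoopWalk6A_prod_estimate (n : ℕ) (τ K β η : ℝ) (P Dk : Fin n → (E3 →L[ℝ] E3))
    (T : E3 →L[ℝ] E3) (hτ : 0 ≤ τ) (hK : 0 ≤ K) (hβ : 0 ≤ β)
    (hP : ∀ k, ‖P k - (ContinuousLinearMap.id ℝ E3 - τ • Dk k)‖ ≤ K * τ ^ 2)
    (hDk : ∀ k, ‖Dk k‖ ≤ β) (hT : ∀ k, ‖Dk k - T‖ ≤ η) :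
    ‖(List.ofFn P).prod‖ ≤ Real.exp (n * (τ * β + K * τ ^ 2)) ∧
    ‖(List.ofFn P).prod - (ContinuousLinearMap.id ℝ E3 + ((n : ℝ) * τ) • (-T))‖ ≤
      Real.exp (n * (τ * β + K * τ ^ 2)) * ((n * (τ * β + K * τ ^ 2)) ^ 2 + n * (K * τ ^ 2)) +
        n * τ * η := by
  set B' : Fin n → (E3 →L[ℝ] E3) := fun k => -Dk k with hB'
  set E' : Fin n → (E3 →L[ℝ] E3) := fun k => P k - (ContinuousLinearMap.id ℝ E3 - τ • Dk k)
    with hE'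
  have hPk : ∀ k, ContinuousLinearMap.id ℝ E3 + τ • B' k + E' k = P k := fun k => by
    simp only [hB', hE', smul_neg]
    abel
  have hlist : List.ofFn P = List.ofFn fun k => ContinuousLinearMap.id ℝ E3 + τ • B' k + E' k := by
    congr 1
    funext k
    exact (hPk k).symm
  have hB'β : ∀ k, ‖B' k‖ ≤ β := fun k => by rw [hB', norm_neg]; exact hDk k
  have hE'ε : ∀ k, ‖E' k‖ ≤ K * τ ^ 2 := fun k => hP k
  have hα : 0 ≤ τ * β + K * τ ^ 2 := by positivity
  have hx : ∀ k, ‖τ • B' k + E' k‖ ≤ τ * β + K * τ ^ 2 := fun k =>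
    (norm_add_le _ _).trans (add_le_add (by
      rw [norm_smul, Real.norm_of_nonneg hτ]
      exact mul_le_mul_of_nonneg_left (hB'β k) hτ) (hE'ε k))
  constructor
  · have h1 : ‖(1 : E3 →L[ℝ] E3)‖ ≤ 1 := ContinuousLinearMap.norm_id_le
    obtain ⟨hP1, -, -⟩ := tautLoopOpProd_norm_prod_le h1 hα n (fun k => τ • B' k + E' k) hx
    have hlist' : List.ofFn P = List.ofFn fun k => (1 : E3 →L[ℝ] E3) + (τ • B' k + E' k) := by
      rw [hlist]
      congr 1
      funext k
      rw [add_assoc]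
      rfl
    rw [hlist']
    refine hP1.trans ?_
    rw [Real.exp_nat_mul]
    exact pow_le_pow_left₀ (by positivity) (by linarith [Real.add_one_le_exp (τ * β + K * τ ^ 2)]) n
  · have hop := stub_tautLoopStepOpProductTools n τ β (K * τ ^ 2) B' E' hτ hβ (by positivity)
      hB'β hE'ε
    rw [← hlist] at hop
    have hdiff : (ContinuousLinearMap.id ℝ E3 + τ • ∑ k : Fin n, B' k) -
        (ContinuousLinearMap.id ℝ E3 + ((n : ℝ) * τ) • (-T)) = -(τ • ∑ k : Fin n, (Dk k - T)) := by
      have hs : ∑ k : Fin n, (Dk k - T) = ∑ k : Fin n, Dk k - (n : ℝ) • T := by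
        rw [Finset.sum_sub_distrib, Finset.sum_const, Finset.card_univ, Fintype.card_fin,
          ← Nat.cast_smul_eq_nsmul ℝ]
      have hs' : ∑ k : Fin n, B' k = -∑ k : Fin n, Dk k := by
        rw [hB', Finset.sum_neg_distrib]
      rw [hs, hs', smul_sub, smul_smul, mul_comm τ (n : ℝ)]
      simp only [smul_neg]
      abel
    have hsum : ‖τ • ∑ k : Fin n, (Dk k - T)‖ ≤ n * τ * η := by
      rw [norm_smul, Real.norm_of_nonneg hτ]
      calc τ * ‖∑ k : Fin n, (Dk k - T)‖ ≤ τ * ∑ k : Fin n, ‖Dk k - T‖ :=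
            mul_le_mul_of_nonneg_left (norm_sum_le _ _) hτ
        _ ≤ τ * ∑ _k : Fin n, η := by gcongr with k; exact hT k
        _ = n * τ * η := by simp; ring
    calc ‖(List.ofFn P).prod - (ContinuousLinearMap.id ℝ E3 + ((n : ℝ) * τ) • (-T))‖
        = ‖((List.ofFn P).prod - (ContinuousLinearMap.id ℝ E3 + τ • ∑ k : Fin n, B' k)) +
            ((ContinuousLinearMap.id ℝ E3 + τ • ∑ k : Fin n, B' k) -
              (ContinuousLinearMap.id ℝ E3 + ((n : ℝ) * τ) • (-T)))‖ := by rw [sub_add_sub_cancel]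
      _ ≤ ‖(List.ofFn P).prod - (ContinuousLinearMap.id ℝ E3 + τ • ∑ k : Fin n, B' k)‖ +
            ‖(ContinuousLinearMap.id ℝ E3 + τ • ∑ k : Fin n, B' k) -
              (ContinuousLinearMap.id ℝ E3 + ((n : ℝ) * τ) • (-T))‖ := norm_add_le _ _
      _ ≤ _ := by
        rw [hdiff, norm_neg]
        exact add_le_add hop hsum

/-- **The composite maps `Ψ_k = Φ_k ∘ ⋯ ∘ Φ_{n-1}`, `Φ_k = A_k + y_k`**, for `C¹` maps `A_k` with
`‖A_k y − y‖ ≤ Kτ` and `‖DA_k(y) − (1 − τ D_k(y))‖ ≤ Kτ²`, `‖D_k(y)‖ ≤ β`: every `Ψ_k` is `C¹`,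
`‖DΨ_0‖ ≤ e^{n(τβ+Kτ²)}`, and whenever the slopes `D_k` along the orbit of `x` are within `η`
of a fixed operator `T`, `‖DΨ_0(x) − (1 − nτ T)‖ ≤ e^{n(τβ+Kτ²)}((n(τβ+Kτ²))² + nKτ²) + nτη`
(chain rule as an ordered product, `stub_tautLoopStepCompositeTools`, and
`tautLoopWalk6A_prod_estimate`). [folklore] -/
theorem tautLoopWalk6A_composite (n : ℕ) (τ K β Dy : ℝ) (A Ψ : ℕ → E3 → E3)
    (Df : ℕ → E3 → (E3 →L[ℝ] E3)) (yv : ℕ → E3)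
    (hτ : 0 ≤ τ) (hK : 0 ≤ K) (hβ : 0 ≤ β) (hDy : 0 ≤ Dy)
    (hA : ∀ k, k < n → ContDiff ℝ 1 (A k)) (hAd : ∀ k, k < n → ∀ y, ‖A k y - y‖ ≤ K * τ)
    (hAT : ∀ k, k < n → ∀ y,
      ‖fderiv ℝ (A k) y - (ContinuousLinearMap.id ℝ E3 - τ • Df k y)‖ ≤ K * τ ^ 2)
    (hDf : ∀ k, k < n → ∀ y, ‖Df k y‖ ≤ β) (hyv : ∀ k, k < n → ‖yv k‖ ≤ Dy)
    (hΨn : ∀ x, Ψ n x = x) (hΨ : ∀ k, k < n → ∀ x, Ψ k x = A k (Ψ (k + 1) x) + yv k) :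
    (∀ k, k ≤ n → ContDiff ℝ 1 (Ψ k)) ∧
    (∀ x, ‖fderiv ℝ (Ψ 0) x‖ ≤ Real.exp (n * (τ * β + K * τ ^ 2))) ∧
    (∀ (T : E3 →L[ℝ] E3) (η : ℝ) (x : E3),
      (∀ k, k < n → ‖Df k (Ψ (k + 1) x) - T‖ ≤ η) →
      ‖fderiv ℝ (Ψ 0) x - (ContinuousLinearMap.id ℝ E3 + ((n : ℝ) * τ) • (-T))‖ ≤
        Real.exp (n * (τ * β + K * τ ^ 2)) * ((n * (τ * β + K * τ ^ 2)) ^ 2 + n * (K * τ ^ 2)) +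
          n * τ * η) := by
  have hΦ : ∀ k, k < n → ContDiff ℝ 1 (fun x => A k x + yv k) := fun k hk =>
    (hA k hk).add contDiff_const
  have hΦD : ∀ k, k < n → ∀ x, ‖(fun x => A k x + yv k) x - x‖ ≤ K * τ + Dy := by
    intro k hk x
    calc ‖A k x + yv k - x‖ = ‖(A k x - x) + yv k‖ := by abel_nf
      _ ≤ ‖A k x - x‖ + ‖yv k‖ := norm_add_le _ _
      _ ≤ K * τ + Dy := add_le_add (hAd k hk x) (hyv k hk)
  obtain ⟨hC1, -, hprod⟩ := stub_tautLoopStepCompositeTools n (fun k x => A k x + yv k) Ψ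
    (K * τ + Dy) (by positivity) hΦ hΦD hΨn hΨ
  have hprod' : ∀ x, fderiv ℝ (Ψ 0) x =
      (List.ofFn fun k : Fin n => fderiv ℝ (A k) (Ψ (k + 1) x)).prod := by
    intro x
    have hfun : (fun k : Fin n => fderiv ℝ (fun x => A k x + yv k) (Ψ (k + 1) x)) =
        fun k : Fin n => fderiv ℝ (A k) (Ψ (k + 1) x) := by
      funext k
      exact fderiv_add_const _
    rw [hprod x, hfun]
  have key : ∀ (T : E3 →L[ℝ] E3) (η : ℝ) (x : E3),
      (∀ k, k < n → ‖Df k (Ψ (k + 1) x) - T‖ ≤ η) →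
      ‖(List.ofFn fun k : Fin n => fderiv ℝ (A k) (Ψ (k + 1) x)).prod‖ ≤
          Real.exp (n * (τ * β + K * τ ^ 2)) ∧
      ‖(List.ofFn fun k : Fin n => fderiv ℝ (A k) (Ψ (k + 1) x)).prod -
          (ContinuousLinearMap.id ℝ E3 + ((n : ℝ) * τ) • (-T))‖ ≤
        Real.exp (n * (τ * β + K * τ ^ 2)) * ((n * (τ * β + K * τ ^ 2)) ^ 2 + n * (K * τ ^ 2)) +
          n * τ * η :=
    fun T η x hT => tautLoopWalk6A_prod_estimate n τ K β η
      (fun k : Fin n => fderiv ℝ (A k) (Ψ (k + 1) x)) (fun k : Fin n => Df k (Ψ (k + 1) x)) T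
      hτ hK hβ (fun k => hAT k k.2 _) (fun k => hDf k k.2 _) (fun k => hT k k.2)
  refine ⟨hC1, fun x => ?_, fun T η x hT => ?_⟩
  · rw [hprod' x]
    exact (key 0 β x (fun k hk => by
      rw [sub_zero]
      exact hDf k hk _)).1
  · rw [hprod' x]
    exact (key T η x hT).2

/-! ## The registered tools stub -/

/-- **Tools stub `stub_tautLoopWalk6AAux2`** (registered; pure auxiliary lemmas, part 2, for the
assembly of skeleton stub 6A `stub_tautLoopWalkSelection`): the first-order expansion of the
ordered product of near-identity differentials and the `C¹` / derivative bounds for the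
composite maps along a deformed orbit. [folklore] -/
theorem stub_tautLoopWalk6AAux2 : (∀ (n : ℕ) (τ K β η : ℝ) (P Dk : Fin n → (EuclideanSpace ℝ (Fin 3) →L[ℝ] EuclideanSpace ℝ (Fin 3))) (T : EuclideanSpace ℝ (Fin 3) →L[ℝ] EuclideanSpace ℝ (Fin 3)), 0 ≤ τ → 0 ≤ K → 0 ≤ β → (∀ k, ‖P k - (ContinuousLinearMap.id ℝ (EuclideanSpace ℝ (Fin 3)) - τ • Dk k)‖ ≤ K * τ ^ 2) → (∀ k, ‖Dk k‖ ≤ β) → (∀ k, ‖Dk k - T‖ ≤ η) → ‖(List.ofFn P).prod‖ ≤ Real.exp (n * (τ * β + K * τ ^ 2)) ∧ ‖(List.ofFn P).prod - (ContinuousLinearMap.id ℝ (EuclideanSpace ℝ (Fin 3)) + ((n : ℝ) * τ) • (-T))‖ ≤ Real.exp (n * (τ * β + K * τ ^ 2)) * ((n * (τ * β + K * τ ^ 2)) ^ 2 + n * (K * τ ^ 2)) + n * τ * η) ∧ (∀ (n : ℕ) (τ K β Dy : ℝ) (A Ψ : ℕ → EuclideanSpace ℝ (Fin 3) → EuclideanSpace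 ℝ (Fin 3)) (Df : ℕ → EuclideanSpace ℝ (Fin 3) → (EuclideanSpace ℝ (Fin 3) →L[ℝ] EuclideanSpace ℝ (Fin 3))) (yv : ℕ → EuclideanSpace ℝ (Fin 3)), 0 ≤ τ → 0 ≤ K → 0 ≤ β → 0 ≤ Dy → (∀ k, k < n → ContDiff ℝ 1 (A k)) → (∀ k, k < n → ∀ y, ‖A k y - y‖ ≤ K * τ) → (∀ k, k < n → ∀ y, ‖fderiv ℝ (A k) y - (ContinuousLinearMap.id ℝ (EuclideanSpace ℝ (Fin 3)) - τ • Df k y)‖ ≤ K * τ ^ 2) → (∀ k, k < n → ∀ y, ‖Df k y‖ ≤ β) → (∀ k, k < n → ‖yv k‖ ≤ Dy) → (∀ x, Ψ n x = x) → (∀ k, k < n → ∀ x, Ψ k x = A k (Ψ (k + 1) x) + yv k) → (∀ k, k ≤ n → ContDiff ℝ 1 (Ψ k)) ∧ (∀ x, ‖fderiv ℝ (Ψ 0) x‖ ≤ Real.exp (n * (τ * β + K * τ ^ 2))) ∧ (∀ (T : EuclideanSpace ℝ (Fin 3) →L[ℝ] EuclideanSpace ℝ (Fin 3)) (η : ℝ)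 (x : EuclideanSpace ℝ (Fin 3)), (∀ k, k < n → ‖Df k (Ψ (k + 1) x) - T‖ ≤ η) → ‖fderiv ℝ (Ψ 0) x - (ContinuousLinearMap.id ℝ (EuclideanSpace ℝ (Fin 3)) + ((n : ℝ) * τ) • (-T))‖ ≤ Real.exp (n * (τ * β + K * τ ^ 2)) * ((n * (τ * β + K * τ ^ 2)) ^ 2 + n * (K * τ ^ 2)) + n * τ * η)) :=
  ⟨tautLoopWalk6A_prod_estimate, tautLoopWalk6A_composite⟩

end Summit.NavierStokesRegularity.NavierStokesRegularity.Theorems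

end
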